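import Summits.BirchSwinnertonDyer.BirchSwinnertonDyer.Theorems.CyclotomicUntwistFormalEndomorphismAlgebra
import Literature.NumberTheory.EllipticCurves.FormalGroupFrobeniusTypeAllPrimesProofs
import Literature.NumberTheory.EllipticCurves.PadicSigma
import HarnessLib

/-!
# Route `CyclotomicUntwist`: endomorphisms of the formal group, II — the DIGIT EXPANSION
# `h̄ = F̄(F̄([a_J](X), [b_J](Xᵖ)), [p^J](g_J))` in `End_{𝔽_p⟦X⟧}(F̄)` with `a_J → A`, `b_J → B` in `ℤ_p`
# («`End(F̄) = ℤ_p[π]`», Katz's rank `2` for a height-`2` formal group, in digits)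

Cell `pub/bsd-wall` (D-0145 line `route-BirchSwinnertonDyer-CyclotomicUntwist` rev 9), prover seat
`bsd-line-cycu-p2` (gen 7), sub-package «W3-core» of the registered stub S2k `stub_KATZ_rankLeTwo_supersingular`
(lines of record `Lines/dfrob_wan.lean` on K1 = stmt-BirchSwinnertonDyer-21580, `Lines/dfrob_kato.lean` on K2 = 21581;
elementary Katz-rank route, memo `Cruxes/PSRankOneLowerHalfAtThree/KATZ-FROBENIUS-MOD-VARPI-v2.md` §2 (iv) and the
lead's 3-adic note of 2026-08-28T13:33Z). THEOREMS ONLY (no definition, no named fact, no `sorry`); helper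
`--supports` 21580; BSD is not proved by this file and no crux or stub is. Sequel of
`CyclotomicUntwistFormalEndomorphismAlgebra` (part I: the law applied to series, closure of `End(F)`).

WHAT. For a Weierstrass curve `E` over `𝔽_p` with formal group law `F̄`, an "endomorphism" is a series `h`,
`h(0) = 0`, `h(F̄(X₀,X₁)) = F̄(h(X₀),h(X₁))` (spelled out, as in cycu-p3's `CyclotomicUntwistFormalEndomorphismFrobenius`,
whose digit-map lemma `exists_hom_expand_of_coeff_one_eq_zero` — «`h'(0) = 0 ⟹ h = g(Xᵖ)`, `g ∈ End`» — is the engine).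
* §1 `hom_X_pow` (`π = Xᵖ` is an endomorphism over `𝔽_p`), `hom_expand` (`g(Xᵖ)` is one if `g` is),
  `expand_subst_pair` (`F̄(u,v)(Xᵖ) = F̄(u(Xᵖ), v(Xᵖ))`).
* §2 **`exists_digit`**: `h = F̄([a](X), g(Xᵖ))`, `a = h'(0) ∈ ℕ`, `g ∈ End` (subtract `[a]`, apply the engine).
* §3 granted an endomorphism `e` with `[p](e(X)) = X^{p²}` («`π² ∈ [p]∘End`»): `expand_expand_eq`
  (`g(X^{p²}) = [p](g(e))`), **`exists_two_digits`** (`k = F̄(F̄([a],[b](Xᵖ)), [p](k₁))`, `k₁ ∈ End`) and, iterating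
  with `[p^J]∘(·)` distributed by `hom_subst_pair` and recombined by `formalMul_add'` and the interchange law,
  **`exists_digitExpansion`**: digits `da db : ℕ → ℕ` and endomorphisms `g_J` with, for EVERY `J`,
  `h = F̄(F̄([∑_{j<J} pʲ da j](X), [∑_{j<J} pʲ db j](Xᵖ)), [p^J](g_J))`.
* §4 **`exists_hom_formalMul_subst_eq_X_pow_sq`**: for `V/ℤ_p` with elliptic fibres and `p ∣ t`
  (`t = p + 1 − #Ṽ(𝔽_p)`), such an `e` EXISTS — `e = F̄([t/p](Xᵖ), i(X))` resp. `F̄(i([|t|/p](Xᵖ)), i(X))` — read off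
  from the tree's Frobenius identity `F̄(X^{p²}, [p](X)) = [t](Xᵖ)` (`frobenius_formal_identity_of_nonneg'/_of_neg'`,
  all primes).
Part III (`CyclotomicUntwistFormalEndomorphismPadicDigits`) packages the partial sums as `p`-adic integers
`A, B` (`‖a_J − A‖ ≤ p^{−J}`) in the shape of the binder `hDig` of cycu-p4's bridge
`CyclotomicUntwistPadicDigitLimit.padicRankTwo_of_honda_of_digits`; with cycu-p3's W1 (`3ᵏg = ℓ∘h`) and cycu-p4's
base change that is the registered stub S2k (`stub_KATZ_rankLeTwo_supersingular_of_padicRankTwo`, p638179);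
nothing here asserts S2k.

References: [cite: Katz1981CrystallineDieudonne, Thm. 5.3.3 and §5.3] (rank of the Dieudonné module = height);
[cite: SilvermanAEC2009, IV.2.3, IV.7.4, V.2.3.1(b)] (homomorphisms of formal groups; `[p]` in characteristic `p`;
`φ² − tφ + p = 0`).
-/

set_option autoImplicit false
-- single-conjunct summit: `Summit.BirchSwinnertonDyer.BirchSwinnertonDyer.…` repeats the name by design
set_option linter.dupNamespace false

noncomputable section

open PowerSeries Literature.NumberTheory.EllipticCurves
  Summit.BirchSwinnertonDyer.BirchSwinnertonDyer.Theorems.FormalEndomorphismAlgebra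

namespace Summit.BirchSwinnertonDyer.BirchSwinnertonDyer.Theorems.FormalEndomorphismDigits

/-! ## §1 Frobenius `π = (X ↦ Xᵖ)` in characteristic `p` -/

section CharP

variable {p : ℕ} [hp : Fact p.Prime] (E : WeierstrassCurve (ZMod p))

/-- `X ↦ Xᵖ` is an endomorphism of `F̄` over `𝔽_p`: `F̄(X,Y)ᵖ = F̄(Xᵖ, Yᵖ)`. [cite: SilvermanAEC2009, IV.7 (proof of Thm. 7.4)] -/
theorem hom_X_pow :
    ((PowerSeries.X : (ZMod p)⟦X⟧) ^ p).subst E.formalGroupLaw =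
      MvPowerSeries.subst ![((PowerSeries.X : (ZMod p)⟦X⟧) ^ p).subst (MvPowerSeries.X 0 : MvPowerSeries (Fin 2) (ZMod p)),
        ((PowerSeries.X : (ZMod p)⟦X⟧) ^ p).subst (MvPowerSeries.X 1 : MvPowerSeries (Fin 2) (ZMod p))] E.formalGroupLaw := by
  have hp0 : p ≠ 0 := hp.out.ne_zero
  rw [PowerSeries.subst_pow E.hasSubst_formalGroupLaw, PowerSeries.subst_X E.hasSubst_formalGroupLaw,
    PowerSeries.subst_pow (PowerSeries.HasSubst.X 0), PowerSeries.subst_X (PowerSeries.HasSubst.X 0),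
    PowerSeries.subst_pow (PowerSeries.HasSubst.X 1), PowerSeries.subst_X (PowerSeries.HasSubst.X 1),
    FormalEndomorphism.pow_prime_eq_expand, MvPowerSeries.expand, MvPowerSeries.substAlgHom_apply]
  congr 1
  funext i
  fin_cases i <;> rfl

/-- `(expand p g) = g ∘ (X ↦ Xᵖ)` is an endomorphism if `g` is. [folklore] -/
theorem hom_expand {g : (ZMod p)⟦X⟧} (hg0 : constantCoeff g = 0)
    (hg : g.subst E.formalGroupLaw =
      MvPowerSeries.subst ![g.subst (MvPowerSeries.X 0 : MvPowerSeries (Fin 2) (ZMod p)),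
        g.subst (MvPowerSeries.X 1 : MvPowerSeries (Fin 2) (ZMod p))] E.formalGroupLaw) :
    (expand p hp.out.ne_zero g).subst E.formalGroupLaw =
      MvPowerSeries.subst ![(expand p hp.out.ne_zero g).subst (MvPowerSeries.X 0 : MvPowerSeries (Fin 2) (ZMod p)),
        (expand p hp.out.ne_zero g).subst (MvPowerSeries.X 1 : MvPowerSeries (Fin 2) (ZMod p))] E.formalGroupLaw := by
  have hXp : constantCoeff ((PowerSeries.X : (ZMod p)⟦X⟧) ^ p) = 0 := by
    rw [map_pow, PowerSeries.constantCoeff_X, zero_pow hp.out.ne_zero]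
  rw [expand_apply]
  exact hom_comp E hg0 hg hXp (hom_X_pow E)

/-- `expand p 0 = 0` bookkeeping: `(expand p g)(0) = g(0)`. [folklore] -/
theorem constantCoeff_expand' (g : (ZMod p)⟦X⟧) :
    constantCoeff (expand p hp.out.ne_zero g) = constantCoeff g :=
  PowerSeries.constantCoeff_expand p hp.out.ne_zero g

/-- `expand` passes inside `F̄(u, v)`: `F̄(u,v)(Xᵖ) = F̄(u(Xᵖ), v(Xᵖ))`. [folklore] -/
theorem expand_subst_pair {u v : (ZMod p)⟦X⟧} (hu : constantCoeff u = 0) (hv : constantCoeff v = 0) :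
    expand p hp.out.ne_zero (MvPowerSeries.subst ![u, v] E.formalGroupLaw) =
      MvPowerSeries.subst ![expand p hp.out.ne_zero u, expand p hp.out.ne_zero v] E.formalGroupLaw := by
  rw [expand_apply, expand_apply, expand_apply]
  exact subst_pair_subst E hu hv (PowerSeries.HasSubst.X_pow hp.out.ne_zero)

/-! ## §2 One digit: `h = [a] ⊕ g(Xᵖ)` with `a = h'(0)` and `g` an endomorphism -/

/-- **The first digit.** For an endomorphism `h` of `F̄` over `𝔽_p`, with `a := h'(0) ∈ {0,…,p−1}`:
`h = F̄([a], g(Xᵖ))` for an endomorphism `g` — since `h ⊖ [a]` is an endomorphism with vanishing linear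
term, hence a series in `Xᵖ` (`FormalEndomorphism.exists_hom_expand_of_coeff_one_eq_zero`).
[cite: Katz1981CrystallineDieudonne, §5.3] [cite: SilvermanAEC2009, IV.7] -/
theorem exists_digit {h : (ZMod p)⟦X⟧} (hh0 : constantCoeff h = 0)
    (hh : h.subst E.formalGroupLaw =
      MvPowerSeries.subst ![h.subst (MvPowerSeries.X 0 : MvPowerSeries (Fin 2) (ZMod p)),
        h.subst (MvPowerSeries.X 1 : MvPowerSeries (Fin 2) (ZMod p))] E.formalGroupLaw) :
    ∃ (a : ℕ) (g : (ZMod p)⟦X⟧), constantCoeff g = 0 ∧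
      g.subst E.formalGroupLaw =
        MvPowerSeries.subst ![g.subst (MvPowerSeries.X 0 : MvPowerSeries (Fin 2) (ZMod p)),
          g.subst (MvPowerSeries.X 1 : MvPowerSeries (Fin 2) (ZMod p))] E.formalGroupLaw ∧
      h = MvPowerSeries.subst ![E.formalMul a, expand p hp.out.ne_zero g] E.formalGroupLaw := by
  set a : ℕ := (coeff 1 h).val with ha
  -- `k := h ⊖ [a]`, `ia := i([a] X) = [a](i(X))`
  set ia : (ZMod p)⟦X⟧ := E.formalNeg.subst (E.formalMul a) with hia_def
  have has : PowerSeries.HasSubst (E.formalMul a) := PowerSeries.HasSubst.of_constantCoeff_zero' (E.constantCoeff_formalMul a)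
  have hia0 : constantCoeff ia = 0 :=
    PowerSeries.constantCoeff_subst_eq_zero (E.constantCoeff_formalMul a) _ E.constantCoeff_formalNeg
  have hia : PowerSeries.subst E.formalGroupLaw ia =
      MvPowerSeries.subst ![PowerSeries.subst (MvPowerSeries.X 0 : MvPowerSeries (Fin 2) (ZMod p)) ia,
        PowerSeries.subst (MvPowerSeries.X 1 : MvPowerSeries (Fin 2) (ZMod p)) ia] E.formalGroupLaw :=
    hom_comp E E.constantCoeff_formalNeg (hom_formalNeg E) (E.constantCoeff_formalMul a) (hom_formalMul E a)
  have hk0 : constantCoeff (MvPowerSeries.subst ![h, ia] E.formalGroupLaw) = 0 := constantCoeff_subst_pair E hh0 hia0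
  have hk := hom_pair E hh0 hh hia0 hia
  have hk1 : coeff 1 (MvPowerSeries.subst ![h, ia] E.formalGroupLaw) = 0 := by
    rw [coeff_one_subst_pair E hh0 hia0, hia_def, coeff_one_subst (E.constantCoeff_formalMul a), E.coeff_one_formalNeg,
      E.coeff_one_formalMul', ha, ZMod.natCast_zmod_val]
    ring
  obtain ⟨g, hg0, hkg, hg⟩ := FormalEndomorphism.exists_hom_expand_of_coeff_one_eq_zero E hk0 hk hk1
  refine ⟨a, g, hg0, hg, ?_⟩
  -- `h = F̄(k, i(i([a]))) = F̄(k, [a]) = F̄([a], k)`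
  have hsol := eq_subst_pair_formalNeg E hh0 hia0 (z := MvPowerSeries.subst ![h, ia] E.formalGroupLaw) rfl
  have hii : E.formalNeg.subst ia = E.formalMul a := by
    rw [hia_def, ← PowerSeries.subst_comp_subst_apply
      (PowerSeries.HasSubst.of_constantCoeff_zero' E.constantCoeff_formalNeg) has, E.formalNeg_subst_formalNeg_eq_X,
      PowerSeries.subst_X has]
  rw [hii, hkg] at hsol
  rw [hsol]
  exact subst_pair_comm E (E.constantCoeff_formalMul a) ((constantCoeff_expand' g).trans hg0)


/-! ## §3 Two digits and one factor `[p]`, granted `π² ∈ [p] ∘ End(F̄)`; the digit expansion -/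

/-- `f ∘ (g(Xᵖ)) = (f ∘ g)(Xᵖ)`. [folklore] -/
theorem subst_expand' (f : (ZMod p)⟦X⟧) {g : (ZMod p)⟦X⟧} (hg0 : constantCoeff g = 0) :
    f.subst (expand p hp.out.ne_zero g) = expand p hp.out.ne_zero (f.subst g) := by
  rw [expand_apply, expand_apply, ← PowerSeries.subst_comp_subst_apply
    (PowerSeries.HasSubst.of_constantCoeff_zero' hg0) (PowerSeries.HasSubst.X_pow hp.out.ne_zero)]

/-- **`g(X^{p²}) = [p](g(e))`** for an endomorphism `g`, when `[p] ∘ e = X^{p²}` (`π² = [p] ∘ e` in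
`End(F̄)`: every endomorphism over `𝔽_p` commutes with `[p]` and with `π`). [cite: Katz1981CrystallineDieudonne, §5.3] -/
theorem expand_expand_eq {e : (ZMod p)⟦X⟧} (he0 : constantCoeff e = 0)
    (hπ : (E.formalMul p).subst e = (PowerSeries.X : (ZMod p)⟦X⟧) ^ p ^ 2)
    {g : (ZMod p)⟦X⟧} (hg0 : constantCoeff g = 0)
    (hg : g.subst E.formalGroupLaw =
      MvPowerSeries.subst ![g.subst (MvPowerSeries.X 0 : MvPowerSeries (Fin 2) (ZMod p)),
        g.subst (MvPowerSeries.X 1 : MvPowerSeries (Fin 2) (ZMod p))] E.formalGroupLaw) :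
    expand p hp.out.ne_zero (expand p hp.out.ne_zero g) = (E.formalMul p).subst (g.subst e) := by
  have hp0 : p ≠ 0 := hp.out.ne_zero
  have hes : PowerSeries.HasSubst e := PowerSeries.HasSubst.of_constantCoeff_zero' he0
  have hgs : PowerSeries.HasSubst g := PowerSeries.HasSubst.of_constantCoeff_zero' hg0
  have hps : PowerSeries.HasSubst (E.formalMul p) := PowerSeries.HasSubst.of_constantCoeff_zero' (E.constantCoeff_formalMul p)
  rw [← expand_mul p hp0 p hp0, expand_apply, ← pow_two, ← hπ, ← PowerSeries.subst_comp_subst_apply hps hes,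
    ← formalMul_subst_hom E hg0 hg p, PowerSeries.subst_comp_subst_apply hgs hes]

/-- **Two digits and one factor `[p]`.** Granted `π² = [p] ∘ e` with `e ∈ End(F̄)`, every endomorphism `k`
is `F̄(F̄([a], [b](Xᵖ)), [p](k₁))` with `a, b ∈ ℕ` and `k₁` an endomorphism. [cite: Katz1981CrystallineDieudonne, §5.3] -/
theorem exists_two_digits {e : (ZMod p)⟦X⟧} (he0 : constantCoeff e = 0)
    (he : e.subst E.formalGroupLaw =
      MvPowerSeries.subst ![e.subst (MvPowerSeries.X 0 : MvPowerSeries (Fin 2) (ZMod p)),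
        e.subst (MvPowerSeries.X 1 : MvPowerSeries (Fin 2) (ZMod p))] E.formalGroupLaw)
    (hπ : (E.formalMul p).subst e = (PowerSeries.X : (ZMod p)⟦X⟧) ^ p ^ 2)
    {k : (ZMod p)⟦X⟧} (hk0 : constantCoeff k = 0)
    (hk : k.subst E.formalGroupLaw =
      MvPowerSeries.subst ![k.subst (MvPowerSeries.X 0 : MvPowerSeries (Fin 2) (ZMod p)),
        k.subst (MvPowerSeries.X 1 : MvPowerSeries (Fin 2) (ZMod p))] E.formalGroupLaw) :
    ∃ (a b : ℕ) (k₁ : (ZMod p)⟦X⟧), constantCoeff k₁ = 0 ∧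
      k₁.subst E.formalGroupLaw =
        MvPowerSeries.subst ![k₁.subst (MvPowerSeries.X 0 : MvPowerSeries (Fin 2) (ZMod p)),
          k₁.subst (MvPowerSeries.X 1 : MvPowerSeries (Fin 2) (ZMod p))] E.formalGroupLaw ∧
      k = MvPowerSeries.subst ![MvPowerSeries.subst ![E.formalMul a, expand p hp.out.ne_zero (E.formalMul b)]
        E.formalGroupLaw, (E.formalMul p).subst k₁] E.formalGroupLaw := by
  obtain ⟨a, g₁, hg₁0, hg₁, hk1⟩ := exists_digit E hk0 hk
  obtain ⟨b, g₂, hg₂0, hg₂, hk2⟩ := exists_digit E hg₁0 hg₁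
  have hk₁0 : constantCoeff (g₂.subst e : (ZMod p)⟦X⟧) = 0 := PowerSeries.constantCoeff_subst_eq_zero he0 _ hg₂0
  refine ⟨a, b, g₂.subst e, hk₁0, hom_comp E hg₂0 hg₂ he0 he, ?_⟩
  have hb0 := E.constantCoeff_formalMul b
  have heb0 : constantCoeff (expand p hp.out.ne_zero (E.formalMul b)) = 0 := (constantCoeff_expand' _).trans hb0
  have hpk0 : constantCoeff ((E.formalMul p).subst (g₂.subst e : (ZMod p)⟦X⟧)) = 0 :=
    PowerSeries.constantCoeff_subst_eq_zero hk₁0 _ (E.constantCoeff_formalMul p)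
  rw [hk1, hk2, expand_subst_pair E hb0 ((constantCoeff_expand' _).trans hg₂0), expand_expand_eq E he0 hπ hg₂0 hg₂,
    ← subst_pair_assoc E (E.constantCoeff_formalMul _) heb0 hpk0]

/-- **THE DIGIT EXPANSION of an endomorphism of `F̄`** (characteristic `p`, `π² ∈ [p] ∘ End(F̄)`): for every
endomorphism `h` there are digits `da db : ℕ → ℕ` and endomorphisms `g J` with, for EVERY `J`,
`h = F̄(F̄([∑_{j<J} pʲ·da j], [∑_{j<J} pʲ·db j](Xᵖ)), [p^J](g J))` — the partial sums are the truncations of two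
`p`-adic integers `A = ∑ pʲ da j`, `B = ∑ pʲ db j` (`h̄ = [A] ⊕ [B]π` in `End(F̄) = ℤ_p[π]`, sequel file).
[cite: Katz1981CrystallineDieudonne, §5.3] [cite: SilvermanAEC2009, IV.7.4] -/
theorem exists_digitExpansion {e : (ZMod p)⟦X⟧} (he0 : constantCoeff e = 0)
    (he : e.subst E.formalGroupLaw =
      MvPowerSeries.subst ![e.subst (MvPowerSeries.X 0 : MvPowerSeries (Fin 2) (ZMod p)),
        e.subst (MvPowerSeries.X 1 : MvPowerSeries (Fin 2) (ZMod p))] E.formalGroupLaw)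
    (hπ : (E.formalMul p).subst e = (PowerSeries.X : (ZMod p)⟦X⟧) ^ p ^ 2)
    {h : (ZMod p)⟦X⟧} (hh0 : constantCoeff h = 0)
    (hh : h.subst E.formalGroupLaw =
      MvPowerSeries.subst ![h.subst (MvPowerSeries.X 0 : MvPowerSeries (Fin 2) (ZMod p)),
        h.subst (MvPowerSeries.X 1 : MvPowerSeries (Fin 2) (ZMod p))] E.formalGroupLaw) :
    ∃ (da db : ℕ → ℕ) (g : ℕ → (ZMod p)⟦X⟧),
      (∀ J, constantCoeff (g J) = 0 ∧ (g J).subst E.formalGroupLaw =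
        MvPowerSeries.subst ![(g J).subst (MvPowerSeries.X 0 : MvPowerSeries (Fin 2) (ZMod p)),
          (g J).subst (MvPowerSeries.X 1 : MvPowerSeries (Fin 2) (ZMod p))] E.formalGroupLaw) ∧
      ∀ J, h = MvPowerSeries.subst ![MvPowerSeries.subst ![E.formalMul (∑ j ∈ Finset.range J, p ^ j * da j),
          expand p hp.out.ne_zero (E.formalMul (∑ j ∈ Finset.range J, p ^ j * db j))] E.formalGroupLaw,
        (E.formalMul (p ^ J)).subst (g J)] E.formalGroupLaw := by
  have hp0 : p ≠ 0 := hp.out.ne_zero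
  -- the endomorphisms of `F̄`, as a subtype, and the two-digit step as a function on it
  let S := {k : (ZMod p)⟦X⟧ // constantCoeff k = 0 ∧ k.subst E.formalGroupLaw =
    MvPowerSeries.subst ![k.subst (MvPowerSeries.X 0 : MvPowerSeries (Fin 2) (ZMod p)),
      k.subst (MvPowerSeries.X 1 : MvPowerSeries (Fin 2) (ZMod p))] E.formalGroupLaw}
  have step : ∀ k : S, ∃ t : ℕ × ℕ × S, (k : (ZMod p)⟦X⟧) =
      MvPowerSeries.subst ![MvPowerSeries.subst ![E.formalMul t.1, expand p hp0 (E.formalMul t.2.1)]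
        E.formalGroupLaw, (E.formalMul p).subst (t.2.2 : (ZMod p)⟦X⟧)] E.formalGroupLaw := fun k => by
    obtain ⟨a, b, k₁, hk₁0, hk₁, hk⟩ := exists_two_digits E he0 he hπ k.2.1 k.2.2
    exact ⟨⟨a, b, ⟨k₁, hk₁0, hk₁⟩⟩, hk⟩
  choose T hT using step
  let s : ℕ → S := fun J => Nat.rec ⟨h, hh0, hh⟩ (fun _ k => (T k).2.2) J
  have hs0 : (s 0).val = h := rfl
  have hsS : ∀ J, (s (J + 1)).val = ((T (s J)).2.2).val := fun J => rfl
  refine ⟨fun j => (T (s j)).1, fun j => (T (s j)).2.1, fun J => (s J).val, fun J => ⟨(s J).property.1, (s J).property.2⟩,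
    fun J => ?_⟩
  induction J with
  | zero =>
    dsimp only
    rw [Finset.sum_range_zero, Finset.sum_range_zero, E.formalMul_zero, map_zero, pow_zero, E.formalMul_one, hs0,
      subst_pair_zero E (map_zero _), PowerSeries.subst_X (PowerSeries.HasSubst.of_constantCoeff_zero' hh0),
      E.formalGroupLaw_subst_zero (PowerSeries.HasSubst.of_constantCoeff_zero' hh0)]
  | succ J ih =>
    dsimp only at ih ⊢
    rw [Finset.sum_range_succ, Finset.sum_range_succ, hsS J]
    -- the step at `s J`, then names for its digits
    have hstep := hT (s J)
    have hk₁0 : constantCoeff ((T (s J)).2.2).val = 0 := (T (s J)).2.2.property.1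
    set a' : ℕ := (T (s J)).1 with ha'
    set b' : ℕ := (T (s J)).2.1 with hb'
    set k₁ : (ZMod p)⟦X⟧ := ((T (s J)).2.2).val with hk₁
    set A : ℕ := ∑ j ∈ Finset.range J, p ^ j * (T (s j)).1 with hA
    set B : ℕ := ∑ j ∈ Finset.range J, p ^ j * (T (s j)).2.1 with hB
    -- constant terms
    have hPJ0 := E.constantCoeff_formalMul (p ^ J)
    have ha0 := E.constantCoeff_formalMul a'
    have hb0 := E.constantCoeff_formalMul b'
    have heb0 : constantCoeff (expand p hp0 (E.formalMul b')) = 0 := (constantCoeff_expand' _).trans hb0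
    have hab0 := constantCoeff_subst_pair E ha0 heb0
    have hpk0 : constantCoeff ((E.formalMul p).subst k₁ : (ZMod p)⟦X⟧) = 0 :=
      PowerSeries.constantCoeff_subst_eq_zero hk₁0 _ (E.constantCoeff_formalMul p)
    have hA0 := E.constantCoeff_formalMul A
    have hB0 := E.constantCoeff_formalMul B
    have heB0 : constantCoeff (expand p hp0 (E.formalMul B)) = 0 := (constantCoeff_expand' _).trans hB0
    have hPJa0 := E.constantCoeff_formalMul (p ^ J * a')
    have hPJb0 := E.constantCoeff_formalMul (p ^ J * b')
    have hePJb0 : constantCoeff (expand p hp0 (E.formalMul (p ^ J * b'))) = 0 := (constantCoeff_expand' _).trans hPJb0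
    have hPk0 : constantCoeff ((E.formalMul (p ^ (J + 1))).subst k₁ : (ZMod p)⟦X⟧) = 0 :=
      PowerSeries.constantCoeff_subst_eq_zero hk₁0 _ (E.constantCoeff_formalMul _)
    -- `[p^J] ∘ (step)`
    have hmul : (E.formalMul (p ^ J)).subst (s J).val =
        MvPowerSeries.subst ![MvPowerSeries.subst ![E.formalMul (p ^ J * a'),
          expand p hp0 (E.formalMul (p ^ J * b'))] E.formalGroupLaw, (E.formalMul (p ^ (J + 1))).subst k₁]
          E.formalGroupLaw := by
      rw [hstep, hom_subst_pair E hPJ0 (hom_formalMul E (p ^ J)) hab0 hpk0,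
        hom_subst_pair E hPJ0 (hom_formalMul E (p ^ J)) ha0 heb0, E.formalMul_mul_subst',
        subst_expand' _ hb0, E.formalMul_mul_subst', pow_succ, ← E.formalMul_mul_subst' (p ^ J) p,
        PowerSeries.subst_comp_subst_apply (PowerSeries.HasSubst.of_constantCoeff_zero' (E.constantCoeff_formalMul p))
          (PowerSeries.HasSubst.of_constantCoeff_zero' hk₁0)]
    rw [ih, hmul, ← subst_pair_assoc E (constantCoeff_subst_pair E hA0 heB0) (constantCoeff_subst_pair E hPJa0 hePJb0) hPk0,
      subst_pair_subst_pair_comm E hA0 heB0 hPJa0 hePJb0, ← E.formalMul_add', ← expand_subst_pair E hB0 hPJb0,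
      ← E.formalMul_add']

end CharP

/-! ## §4 Supersingular fibres: `π² ∈ [p] ∘ End(F̄)` from the Frobenius identity `π² − [t]π + [p] = 0`, `p ∣ t` -/

section Supersingular

variable {p : ℕ} [hp : Fact p.Prime] (V : WeierstrassCurve ℤ_[p]) [hE : (V.map PadicInt.Coe.ringHom).IsElliptic]
  [hEt : (V.map PadicInt.toZMod).IsElliptic]

/-- `[p·c](Xᵖ) = [p]([c](Xᵖ))`. [folklore] -/
theorem formalMul_prime_mul_expand (E : WeierstrassCurve (ZMod p)) (c : ℕ) :
    expand p hp.out.ne_zero (E.formalMul (p * c)) = (E.formalMul p).subst (expand p hp.out.ne_zero (E.formalMul c)) := by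
  rw [← E.formalMul_mul_subst', subst_expand' _ (E.constantCoeff_formalMul c)]

/-- **`π² ∈ [p] ∘ End(F̄)` on a fibre with `p ∣ t`** (`t = p + 1 − #Ẽ(𝔽_p)`; supersingular when `p ≥ 5`, and the
case of the principal-series rows at `p = 3`, `t ∈ {0, ±3}`): there is an endomorphism `e` of `F̄` with `[p](e(X)) = X^{p²}`
— namely `e = F̄([t/p](Xᵖ), i(X))` (resp. `F̄(i([|t|/p](Xᵖ)), i(X))`), read off from the tree's Frobenius identity
`F̄(X^{p²}, [p](X)) = [t](Xᵖ)` (`frobenius_formal_identity_of_nonneg'/_of_neg'`).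
[cite: SilvermanAEC2009, Thm. V.2.3.1(b)] [cite: Katz1981CrystallineDieudonne, §5.3] -/
theorem exists_hom_formalMul_subst_eq_X_pow_sq
    (hdvd : (p : ℤ) ∣ Literature.NumberTheory.EllipticCurves.HasseManin.tr (V.map PadicInt.toZMod)) :
    ∃ e : (ZMod p)⟦X⟧, constantCoeff e = 0 ∧
      e.subst (V.map PadicInt.toZMod).formalGroupLaw =
        MvPowerSeries.subst ![e.subst (MvPowerSeries.X 0 : MvPowerSeries (Fin 2) (ZMod p)),
          e.subst (MvPowerSeries.X 1 : MvPowerSeries (Fin 2) (ZMod p))] (V.map PadicInt.toZMod).formalGroupLaw ∧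
      ((V.map PadicInt.toZMod).formalMul p).subst e = (PowerSeries.X : (ZMod p)⟦X⟧) ^ p ^ 2 := by
  set E := V.map PadicInt.toZMod with hEdef
  set t := Literature.NumberTheory.EllipticCurves.HasseManin.tr (V.map PadicInt.toZMod) with htdef
  have hp0 : p ≠ 0 := hp.out.ne_zero
  have hX : constantCoeff (PowerSeries.X : (ZMod p)⟦X⟧) = 0 := PowerSeries.constantCoeff_X
  have hXp2 : constantCoeff ((PowerSeries.X : (ZMod p)⟦X⟧) ^ p ^ 2) = 0 := by
    rw [map_pow, hX, zero_pow (pow_ne_zero 2 hp0)]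
  have hi0 := E.constantCoeff_formalNeg
  have hP0 := E.constantCoeff_formalMul p
  have hPs : PowerSeries.HasSubst (E.formalMul p) := PowerSeries.HasSubst.of_constantCoeff_zero' hP0
  -- `[p] ∘ i = i ∘ [p]`
  have hPi : (E.formalMul p).subst E.formalNeg = E.formalNeg.subst (E.formalMul p) := formalMul_subst_hom E hi0 (hom_formalNeg E) p
  obtain ⟨c, hc⟩ : ∃ c : ℕ, t.natAbs = p * c := by
    obtain ⟨d, hd⟩ := hdvd
    refine ⟨d.natAbs, ?_⟩
    rw [hd, Int.natAbs_mul, Int.natAbs_natCast]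
  have hc0 := E.constantCoeff_formalMul c
  have hec0 : constantCoeff (expand p hp0 (E.formalMul c)) = 0 := (constantCoeff_expand' _).trans hc0
  have hec : (expand p hp0 (E.formalMul c)).subst E.formalGroupLaw =
      MvPowerSeries.subst ![(expand p hp0 (E.formalMul c)).subst (MvPowerSeries.X 0 : MvPowerSeries (Fin 2) (ZMod p)),
        (expand p hp0 (E.formalMul c)).subst (MvPowerSeries.X 1 : MvPowerSeries (Fin 2) (ZMod p))] E.formalGroupLaw :=
    hom_expand E hc0 (hom_formalMul E c)
  rcases le_or_gt 0 t with ht | ht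
  · -- `F̄(X^{p²}, [p]) = [t](Xᵖ) = [p]([c](Xᵖ))`, so `X^{p²} = F̄([p]([c](Xᵖ)), i([p])) = [p](F̄([c](Xᵖ), i))`
    have hid := V.frobenius_formal_identity_of_nonneg' ht
    rw [PowerSeries.X_subst, ← expand_apply p hp0, show t.toNat = p * c by rw [← Int.natAbs_of_nonneg ht]; exact hc,
      formalMul_prime_mul_expand] at hid
    have hsol := eq_subst_pair_formalNeg E hXp2 hP0 hid
    refine ⟨MvPowerSeries.subst ![expand p hp0 (E.formalMul c), E.formalNeg] E.formalGroupLaw,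
      constantCoeff_subst_pair E hec0 hi0, hom_pair E hec0 hec hi0 (hom_formalNeg E), ?_⟩
    rw [hom_subst_pair E hP0 (hom_formalMul E p) hec0 hi0, hPi]
    exact hsol.symm
  · -- `F̄(X^{p²}, [p]) = i([|t|](Xᵖ)) = [p](i([c](Xᵖ)))`
    have hid := V.frobenius_formal_identity_of_neg' ht
    rw [PowerSeries.X_subst, ← expand_apply p hp0, hc, formalMul_prime_mul_expand,
      ← PowerSeries.subst_comp_subst_apply hPs (PowerSeries.HasSubst.of_constantCoeff_zero' hec0), ← hPi,
      PowerSeries.subst_comp_subst_apply (PowerSeries.HasSubst.of_constantCoeff_zero' hi0)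
        (PowerSeries.HasSubst.of_constantCoeff_zero' hec0)] at hid
    have hiec0 : constantCoeff (E.formalNeg.subst (expand p hp0 (E.formalMul c)) : (ZMod p)⟦X⟧) = 0 :=
      PowerSeries.constantCoeff_subst_eq_zero hec0 _ hi0
    have hiec := hom_comp E hi0 (hom_formalNeg E) hec0 hec
    have hsol := eq_subst_pair_formalNeg E hXp2 hP0 hid
    refine ⟨MvPowerSeries.subst ![E.formalNeg.subst (expand p hp0 (E.formalMul c)), E.formalNeg] E.formalGroupLaw,
      constantCoeff_subst_pair E hiec0 hi0, hom_pair E hiec0 hiec hi0 (hom_formalNeg E), ?_⟩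
    rw [hom_subst_pair E hP0 (hom_formalMul E p) hiec0 hi0, hPi]
    exact hsol.symm

end Supersingular


end Summit.BirchSwinnertonDyer.BirchSwinnertonDyer.Theorems.FormalEndomorphismDigits

end
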